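import Summits.Ventures.LatticeQCDFlow.Scoring.SU2TorusCharacterInsertion
import Summits.Ventures.LatticeQCDFlow.Scoring.SU2TorusPlaquette
import HarnessLib

/-!
# SU(2) on the 2-torus: THE GENERAL CHARACTER MOMENTS `⟨χ_j(U_{x₀})⟩_{(ℤ/L)², β}` exactly

HONEST FRAMING: exact (Metropolis-corrected) sampling algorithms for lattice gauge theory;
figures of merit are autocorrelation/cost numbers at stated couplings and volumes; no
continuum-physics claim.

Venture `LatticeQCDFlow` (cell pub-lqcd), sub-topic `Scoring`; FANOUT row 5 (`s0-sun-a`), GEN-13.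
NEW WORK of the cell (placement rule): the NOT-TYPED item 'general moments `⟨χ_j(U_p)⟩`' (GEN-12).
`Scoring/SU2TorusPlaquette.lean` (GEN-10) computed `⟨½ tr U_{x₀}⟩ = ⟨½ χ_1⟩`; with the Clebsch–Gordan
insertion of `Scoring/SU2TorusCharacterInsertion.lean` the same assembly gives every character moment.
With `c_n(β) = e^{−2β}(I_n(2β) − I_{n+2}(2β))` (Haar character coefficients of the plaquette weight):

* `integral_chebyshevU_div_mul_exp_neg_wilsonAction_eq_tsum` — the character expansion of the
  insertion of the bounded observable `χ_j(U_{x₀})/(j+1)`;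
* **`hasSum_integral_chebyshevU_div_mul_exp_neg_wilsonAction_two`** — only the assignments
  `x ≡ w + j − i` off `x₀`, `x_{x₀} = w + i` (`0 ≤ i ≤ j`, `w ≥ 0`) survive, whence
  `∫ χ_j(U_{x₀})/(j+1) · e^{−βS} dHaar^{⊗E} = (1/(j+1)) Σ_{i=0}^{j} Σ_{w≥0} c_{w+i} c_{w+j−i}^{L²−1}/(w+j−i+1)^{L²}`;
* **`wilson_mean_chebyshevU_plaquette_two`** — THE EXACT CHARACTER MOMENTS:
  `⟨χ_j(U_{x₀})⟩_{(ℤ/L)²,β} = Σ_{i=0}^{j} Σ_{w≥0} c_{w+i} c_{w+j−i}^{L²−1}/(w+j−i+1)^{L²} / Σ_n (c_n/(n+1))^{L²}`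
  for every `L ≥ 1`, `β ≥ 0`, `j ∈ ℕ` (`j = 1` is twice GEN-10's plaquette; as `L → ∞` the `w = 0, i = j`
  term dominates: `⟨χ_j⟩ → c_j/c_0 = (j+1) I_{j+1}(2β)/I_1(2β)`, GEN-9's one-plaquette value).

Since the `χ_j` span the class functions, this is the complete single-plaquette law of the torus.
Nothing is cited; no `def`.
-/

noncomputable section

open Real MeasureTheory Set Function Finset Polynomial.Chebyshev
open Literature.MathematicalPhysics.QuantumFieldTheory Literature.MathematicalPhysics.QuantumLattice
open Literature.Analysis.FunctionSpaces
open Summit.Ventures.LatticeQCDFlow.Exactness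
open Summit.Ventures.LatticeQCDFlow.Theory2.Lattice

namespace Summit.Ventures.LatticeQCDFlow.Scoring

variable {L : ℕ} [NeZero L]

/-! ## §1. The character expansion of the `χ_j/(j+1)` insertion -/

/-- `|χ_j(U)/(j+1)| ≤ 1`. -/
theorem abs_chebyshevU_su2a0_div_le_one (j : ℕ) (V : Matrix.specialUnitaryGroup (Fin 2) ℂ) :
    |(U ℝ j).eval (su2a0 V) / ((j : ℝ) + 1)| ≤ 1 := by
  have hj : (0 : ℝ) < (j : ℝ) + 1 := by positivity
  rw [abs_div, abs_of_pos hj, div_le_one hj]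
  exact abs_chebyshevU_eval_le j (abs_su2a0_le_one V)

/-- **The `χ_j/(j+1)` insertion, expanded in characters** (`β ≥ 0`): absolutely convergent series over
the assignments `x : plaquettes → ℕ`. -/
theorem integral_chebyshevU_div_mul_exp_neg_wilsonAction_eq_tsum {β : ℝ} (hβ : 0 ≤ β) (x₀ : Site 2 L)
    (j : ℕ) :
    (Summable fun x : Plaquette 2 L → ℕ => (∏ p, Real.exp (-(2 * β)) *
        (besselI (x p) (2 * β) - besselI (x p + 2) (2 * β))) *
        ∫ V, (U ℝ j).eval (su2a0 (plaquetteHolonomy V x₀ 0 1)) / ((j : ℝ) + 1) *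
          ∏ p : Plaquette 2 L, (U ℝ (x p)).eval (su2a0 (plaquetteHolonomy V p.1 p.2.1.1 p.2.1.2))
          ∂(Measure.pi fun _ : Edge 2 L => haarProbability (Matrix.specialUnitaryGroup (Fin 2) ℂ))) ∧
    ∫ V, (U ℝ j).eval (su2a0 (plaquetteHolonomy V x₀ 0 1)) / ((j : ℝ) + 1) *
        Real.exp (-β * wilsonAction (fundamentalRep (Fin 2)) V)
        ∂(Measure.pi fun _ : Edge 2 L => haarProbability (Matrix.specialUnitaryGroup (Fin 2) ℂ)) =
      ∑' x : Plaquette 2 L → ℕ, (∏ p, Real.exp (-(2 * β)) *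
        (besselI (x p) (2 * β) - besselI (x p + 2) (2 * β))) *
        ∫ V, (U ℝ j).eval (su2a0 (plaquetteHolonomy V x₀ 0 1)) / ((j : ℝ) + 1) *
          ∏ p : Plaquette 2 L, (U ℝ (x p)).eval (su2a0 (plaquetteHolonomy V p.1 p.2.1.1 p.2.1.2))
          ∂(Measure.pi fun _ : Edge 2 L => haarProbability (Matrix.specialUnitaryGroup (Fin 2) ℂ)) := by
  haveI := secondCountableTopology_su2
  have ham : ∀ p : Plaquette 2 L, Measurable fun V : GaugeConfig 2 L (Matrix.specialUnitaryGroup (Fin 2) ℂ) =>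
      su2a0 (plaquetteHolonomy V p.1 p.2.1.1 p.2.1.2) :=
    fun p => continuous_su2a0.measurable.comp
      (Literature.MathematicalPhysics.QuantumFieldTheory.measurable_plaquetteHolonomy p.1 p.2.1.1 p.2.1.2)
  have ha : ∀ (p : Plaquette 2 L) (V : GaugeConfig 2 L (Matrix.specialUnitaryGroup (Fin 2) ℂ)),
      su2a0 (plaquetteHolonomy V p.1 p.2.1.1 p.2.1.2) ∈ Icc (-1 : ℝ) 1 :=
    fun p V => abs_le.mp (abs_su2a0_le_one _)
  have hgc : Continuous fun V : GaugeConfig 2 L (Matrix.specialUnitaryGroup (Fin 2) ℂ) =>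
      (U ℝ j).eval (su2a0 (plaquetteHolonomy V x₀ 0 1)) / ((j : ℝ) + 1) :=
    (continuous_su2Character_comp j (by unfold plaquetteHolonomy; fun_prop)).div_const _
  have h := integral_mul_prod_plaqWeight_eq_tsum_fintype
    (Measure.pi fun _ : Edge 2 L => haarProbability (Matrix.specialUnitaryGroup (Fin 2) ℂ)) hβ
    (fun (p : Plaquette 2 L) (V : GaugeConfig 2 L (Matrix.specialUnitaryGroup (Fin 2) ℂ)) =>
      su2a0 (plaquetteHolonomy V p.1 p.2.1.1 p.2.1.2)) ham ha
    (fun V => (U ℝ j).eval (su2a0 (plaquetteHolonomy V x₀ 0 1)) / ((j : ℝ) + 1)) hgc.measurable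
    (fun V => abs_chebyshevU_su2a0_div_le_one j _)
  refine ⟨h.1, ?_⟩
  rw [← h.2]
  refine integral_congr_ae (Filter.Eventually.of_forall fun V => ?_)
  beta_reduce
  rw [exp_neg_mul_wilsonAction_su2 β V]

/-! ## §2. The expansion term -/

/-- **The expansion term of the `χ_j/(j+1)` insertion**: with the base-site assignment `m` of `x`,
`(∏_p c_{x_p}) ∫ χ_j(U_{x₀})/(j+1) ∏_p χ_{x_p}(U_p) = (∏_p c_{x_p})·(1/(j+1))·Σ_{i≤j} [i ≤ m_{x₀}] I(m^{(i)})`. -/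
theorem character_insertion_term_two (β : ℝ) (x₀ : Site 2 L) (j : ℕ) (x : Plaquette 2 L → ℕ) :
    (∏ p, Real.exp (-(2 * β)) * (besselI (x p) (2 * β) - besselI (x p + 2) (2 * β))) *
        ∫ V, (U ℝ j).eval (su2a0 (plaquetteHolonomy V x₀ 0 1)) / ((j : ℝ) + 1) *
          ∏ p : Plaquette 2 L, (U ℝ (x p)).eval (su2a0 (plaquetteHolonomy V p.1 p.2.1.1 p.2.1.2))
          ∂(Measure.pi fun _ : Edge 2 L => haarProbability (Matrix.specialUnitaryGroup (Fin 2) ℂ)) =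
      (∏ p, Real.exp (-(2 * β)) * (besselI (x p) (2 * β) - besselI (x p + 2) (2 * β))) *
        ((1 / ((j : ℝ) + 1)) * ∑ i ∈ Finset.range (j + 1),
          (if i ≤ x (x₀, ⟨((0 : Fin 2), (1 : Fin 2)), by decide⟩) then
            (if (∀ s : Site 2 L,
                update (fun s : Site 2 L => x (s, ⟨((0 : Fin 2), (1 : Fin 2)), by decide⟩)) x₀
                    (j + x (x₀, ⟨((0 : Fin 2), (1 : Fin 2)), by decide⟩) - 2 * i) s =
                  update (fun s : Site 2 L => x (s, ⟨((0 : Fin 2), (1 : Fin 2)), by decide⟩)) x₀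
                    (j + x (x₀, ⟨((0 : Fin 2), (1 : Fin 2)), by decide⟩) - 2 * i) 0) then
              ((((update (fun s : Site 2 L => x (s, ⟨((0 : Fin 2), (1 : Fin 2)), by decide⟩)) x₀
                (j + x (x₀, ⟨((0 : Fin 2), (1 : Fin 2)), by decide⟩) - 2 * i) 0 : ℕ) : ℝ) + 1) ^
                  (L ^ 2))⁻¹ else 0) else 0)) := by
  congr 1
  have hint : (fun V : GaugeConfig 2 L (Matrix.specialUnitaryGroup (Fin 2) ℂ) =>
      (U ℝ j).eval (su2a0 (plaquetteHolonomy V x₀ 0 1)) / ((j : ℝ) + 1) *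
        ∏ p : Plaquette 2 L, (U ℝ (x p)).eval (su2a0 (plaquetteHolonomy V p.1 p.2.1.1 p.2.1.2))) =
      fun V => (1 / ((j : ℝ) + 1)) * ((U ℝ j).eval (su2a0 (plaquetteHolonomy V x₀ 0 1)) *
        ∏ s : Site 2 L, (U ℝ ((fun s : Site 2 L => x (s, ⟨((0 : Fin 2), (1 : Fin 2)), by decide⟩)) s)).eval
          (su2a0 (plaquetteHolonomy V s 0 1))) := by
    funext V
    rw [prod_plaquette_two]
    ring
  rw [hint, integral_const_mul, integral_chebyshevU_mul_prod_su2Character_plaquettes]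

/-! ## §3. The insertion as a double series over `(i, w)` -/

/-- **`∫ χ_j(U_{x₀})/(j+1) · e^{−βS} dHaar^{⊗E} = (1/(j+1)) Σ_{i=0}^{j} Σ_w c_{w+i} c_{w+j−i}^{L²−1}/(w+j−i+1)^{L²}`**
(`β ≥ 0`, `L ≥ 1`, `j ∈ ℕ`; `j − i` is natural subtraction with `i ≤ j`; `c_n = e^{−2β}(I_n(2β) − I_{n+2}(2β))`). -/
theorem integral_chebyshevU_div_mul_exp_neg_wilsonAction_two {β : ℝ} (hβ : 0 ≤ β) (x₀ : Site 2 L)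
    (j : ℕ) :
    ∫ V, (U ℝ j).eval (su2a0 (plaquetteHolonomy V x₀ 0 1)) / ((j : ℝ) + 1) *
        Real.exp (-β * wilsonAction (fundamentalRep (Fin 2)) V)
        ∂(Measure.pi fun _ : Edge 2 L => haarProbability (Matrix.specialUnitaryGroup (Fin 2) ℂ)) =
      (1 / ((j : ℝ) + 1)) * ∑ i ∈ Finset.range (j + 1), ∑' w : ℕ,
        (Real.exp (-(2 * β)) * (besselI (w + i) (2 * β) - besselI (w + i + 2) (2 * β))) *
          (Real.exp (-(2 * β)) * (besselI (w + (j - i)) (2 * β) - besselI (w + (j - i) + 2) (2 * β))) ^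
            (L ^ 2 - 1) *
          ((((w + (j - i) : ℕ) : ℝ) + 1) ^ (L ^ 2))⁻¹ := by
  obtain ⟨hsum, hN⟩ := integral_chebyshevU_div_mul_exp_neg_wilsonAction_eq_tsum (L := L) hβ x₀ j
  -- abbreviations: the plane, the observed plaquette, the coefficients
  set pl : {p : Fin 2 × Fin 2 // p.1 < p.2} := ⟨((0 : Fin 2), (1 : Fin 2)), by decide⟩ with hpl
  set p₀ : Plaquette 2 L := (x₀, pl) with hp₀
  set c : ℕ → ℝ := fun n => Real.exp (-(2 * β)) * (besselI n (2 * β) - besselI (n + 2) (2 * β)) with hc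
  have hc0 : ∀ n, 0 ≤ c n := fun n => charCoeff_nonneg hβ n
  have hj1 : (0 : ℝ) < 1 / ((j : ℝ) + 1) := by positivity
  -- the `j + 1` surviving families of terms
  set T : ℕ → (Plaquette 2 L → ℕ) → ℝ := fun i x => (∏ p, c (x p)) * ((1 / ((j : ℝ) + 1)) *
    (if i ≤ x p₀ then
      (if (∀ s : Site 2 L, update (fun s : Site 2 L => x (s, pl)) x₀ (j + x p₀ - 2 * i) s =
          update (fun s : Site 2 L => x (s, pl)) x₀ (j + x p₀ - 2 * i) 0) then
        ((((update (fun s : Site 2 L => x (s, pl)) x₀ (j + x p₀ - 2 * i) 0 : ℕ) : ℝ) + 1) ^ (L ^ 2))⁻¹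
        else 0) else 0)) with hT
  have hterm : ∀ x : Plaquette 2 L → ℕ,
      (∏ p, Real.exp (-(2 * β)) * (besselI (x p) (2 * β) - besselI (x p + 2) (2 * β))) *
      ∫ V, (U ℝ j).eval (su2a0 (plaquetteHolonomy V x₀ 0 1)) / ((j : ℝ) + 1) *
        ∏ p : Plaquette 2 L, (U ℝ (x p)).eval (su2a0 (plaquetteHolonomy V p.1 p.2.1.1 p.2.1.2))
        ∂(Measure.pi fun _ : Edge 2 L => haarProbability (Matrix.specialUnitaryGroup (Fin 2) ℂ)) =
      ∑ i ∈ Finset.range (j + 1), T i x := by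
    intro x
    rw [character_insertion_term_two β x₀ j x, hT, hc, Finset.mul_sum, Finset.mul_sum]
  simp_rw [hterm] at hsum hN
  have hprod0 : ∀ x : Plaquette 2 L → ℕ, 0 ≤ ∏ p, c (x p) := fun x => Finset.prod_nonneg fun p _ => hc0 _
  have hT0 : ∀ i x, 0 ≤ T i x := by
    intro i x
    rw [hT]
    refine mul_nonneg (hprod0 x) (mul_nonneg hj1.le ?_)
    split_ifs <;> positivity
  have hTs : ∀ i ∈ Finset.range (j + 1), Summable (T i) := fun i hi =>
    Summable.of_nonneg_of_le (hT0 i) (fun x => Finset.single_le_sum (fun k _ => hT0 k x) hi) hsum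
  rw [hN, Summable.tsum_finsetSum hTs, Finset.mul_sum]
  refine Finset.sum_congr rfl fun i hi => ?_
  have hij : i ≤ j := Nat.lt_succ_iff.mp (Finset.mem_range.mp hi)
  -- the surviving assignments of family `i`: `x ≡ w + (j − i)` off `p₀`, `x_{p₀} = w + i`
  set g : ℕ → (Plaquette 2 L → ℕ) := fun w => update (fun _ => w + (j - i)) p₀ (w + i) with hg
  have hginj : Injective g := fun w w' h => by
    have := congrFun h p₀
    simpa [hg] using this
  have hbase : ∀ p : Plaquette 2 L, p ≠ p₀ → p.1 ≠ x₀ := by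
    intro p hp h1
    exact hp (by rw [plaquette_two_eq p, h1])
  have hsupp : support (T i) ⊆ Set.range g := by
    intro x hx
    rw [mem_support, hT] at hx
    simp only at hx
    have hle : i ≤ x p₀ := by
      by_contra h
      rw [if_neg h, mul_zero, mul_zero] at hx
      exact hx rfl
    rw [if_pos hle] at hx
    have hcst : ∀ s : Site 2 L, update (fun s : Site 2 L => x (s, pl)) x₀ (j + x p₀ - 2 * i) s =
        update (fun s : Site 2 L => x (s, pl)) x₀ (j + x p₀ - 2 * i) 0 := by
      by_contra h
      rw [if_neg h, mul_zero, mul_zero] at hx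
      exact hx rfl
    refine ⟨x p₀ - i, funext fun p => ?_⟩
    by_cases hp : p = p₀
    · rw [hp, hg]
      simp only [update_self]
      omega
    · rw [hg]
      simp only [update_of_ne hp]
      have h1 := hcst p.1
      rw [update_of_ne (hbase p hp), ← hcst x₀, update_self] at h1
      rw [plaquette_two_eq p, h1]
      omega
  -- the value on the surviving assignments
  have hup : ∀ w : ℕ, update (fun s : Site 2 L => g w (s, pl)) x₀ (j + g w p₀ - 2 * i) =
      fun _ => w + (j - i) := by
    intro w
    funext s
    by_cases hs : s = x₀
    · rw [hs, update_self, hg]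
      simp only [update_self]
      omega
    · rw [update_of_ne hs, hg]
      have : ((s, pl) : Plaquette 2 L) ≠ p₀ := fun h => hs (congrArg Prod.fst h)
      simp [update_of_ne this]
  have hTg : ∀ w : ℕ, T i (g w) = (1 / ((j : ℝ) + 1)) * (c (w + i) * c (w + (j - i)) ^ (L ^ 2 - 1) *
      ((((w + (j - i) : ℕ) : ℝ) + 1) ^ (L ^ 2))⁻¹) := by
    intro w
    rw [hT]
    simp only
    have hle : i ≤ g w p₀ := by rw [hg]; simp
    rw [if_pos hle, hup w, if_pos (fun _ => rfl), hg, prod_update_const]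
    ring
  -- assemble
  rw [← hginj.tsum_eq hsupp, ← tsum_mul_left]
  refine tsum_congr fun w => ?_
  simp only [hTg, hc]

/-! ## §4. The exact character moments of the torus -/

/-- **THE EXACT SU(2) CHARACTER MOMENTS ON THE 2-TORUS.**  For every `L ≥ 1`, `β ≥ 0`, `j ∈ ℕ` and
plaquette `x₀` of `(ℤ/L)²`, under theory-2's Wilson measure `wilsonMeasure (fundamentalRep (Fin 2)) β`:
`⟨χ_j(U_{x₀})⟩ = ⟨U_j(½ tr U_{x₀})⟩ = Σ_{i=0}^{j} Σ_{w≥0} c_{w+i} c_{w+j−i}^{L²−1}/(w+j−i+1)^{L²} / Σ_n (c_n/(n+1))^{L²}`,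
`c_n = e^{−2β}(I_n(2β) − I_{n+2}(2β))` — every single-plaquette moment of the finite-volume measure
(`χ_j` span the class functions); `j = 1` is twice GEN-10's `⟨½ tr U⟩`. -/
theorem wilson_mean_chebyshevU_plaquette_two {β : ℝ} (hβ : 0 ≤ β) (x₀ : Site 2 L) (j : ℕ) :
    ∫ V, (U ℝ j).eval (su2a0 (plaquetteHolonomy V x₀ 0 1))
        ∂(wilsonMeasure (d := 2) (L := L) (fundamentalRep (Fin 2)) β) =
      (∑ i ∈ Finset.range (j + 1), ∑' w : ℕ,
        (Real.exp (-(2 * β)) * (besselI (w + i) (2 * β) - besselI (w + i + 2) (2 * β))) *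
          (Real.exp (-(2 * β)) * (besselI (w + (j - i)) (2 * β) - besselI (w + (j - i) + 2) (2 * β))) ^
            (L ^ 2 - 1) *
          ((((w + (j - i) : ℕ) : ℝ) + 1) ^ (L ^ 2))⁻¹) /
      ∑' n : ℕ, (Real.exp (-(2 * β)) * (besselI n (2 * β) - besselI (n + 2) (2 * β)) /
        ((n : ℝ) + 1)) ^ (L ^ 2) := by
  have hj : ((j : ℝ) + 1) ≠ 0 := by positivity
  rw [integral_wilsonMeasure_su2_eq_div, partitionFunction_su2_two_toReal_eq_tsum hβ]
  congr 1
  have h := integral_chebyshevU_div_mul_exp_neg_wilsonAction_two (L := L) hβ x₀ j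
  have hdiv : ∫ V, (U ℝ j).eval (su2a0 (plaquetteHolonomy V x₀ 0 1)) / ((j : ℝ) + 1) *
        Real.exp (-β * wilsonAction (fundamentalRep (Fin 2)) V)
        ∂(Measure.pi fun _ : Edge 2 L => haarProbability (Matrix.specialUnitaryGroup (Fin 2) ℂ)) =
      (1 / ((j : ℝ) + 1)) * ∫ V, (U ℝ j).eval (su2a0 (plaquetteHolonomy V x₀ 0 1)) *
        Real.exp (-β * wilsonAction (fundamentalRep (Fin 2)) V)
        ∂(Measure.pi fun _ : Edge 2 L => haarProbability (Matrix.specialUnitaryGroup (Fin 2) ℂ)) := by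
    rw [← integral_const_mul]
    refine integral_congr_ae (Filter.Eventually.of_forall fun V => ?_)
    simp only
    ring
  rw [hdiv] at h
  have := mul_left_cancel₀ (one_div_ne_zero hj) h
  exact this

end Summit.Ventures.LatticeQCDFlow.Scoring
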